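import Literature.NumberTheory.Sieve.SmoothParitySingularBounds
import Literature.NumberTheory.Sieve.SmoothProfileModelBounds
import HarnessLib

/-!
# Parity-class friable ternary counts with W-class profiles: the objects and the zeroth-order asymptotic (statement)

Topic `Literature/NumberTheory/Sieve`; a DEFINITIONS file of the circle-method engine for `y`-friable solutions of
`d₁ n₁ + σ d₂ n₂ = n₃` (`σ = ±1`) with `n₁, n₂` ODD, `n₃` free, smooth W-class profile weights `p_{c_i}(n_i/X_i)` at scales
`X_i = x/e_i` on the common saddle line `α = α(x, y)` ([Harper2016, §5] for `a + b = c`; [LagariasSoundararajan2012] for the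
conditional asymptotic).  Contents:

* `parityTernarySum` — the weighted solution count `Σ 1[d₁n₁ + σd₂n₂ = n₃] p₁ p₂ p̄₃` over friable `n_i ≤ X_i`, `n₁, n₂` odd;
* `parityModelCount` — the same sum with the MODEL weights `μ_i(n) = (Mv_i/X_i)(n/X_i)^{α−1} p_{c_i}(n/X_i)` of
  `SmoothProfileModel` over ALL `1 ≤ n_i ≤ X_i` (`Mv_i = e_i^{−α}𝓜`, `𝓜 = x^α ζ(α,y)/√(2πφ₂(α,y))`): the singular integral in
  discrete, manifestly nonnegative form;
* `ParityTernaryAsymptotic` — the ZEROTH-ORDER ASYMPTOTIC as a `Prop` (proved in the companion files):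
  given the GRH-type currency for non-principal friable character sums, for every `B` and `ε > 0`, for `x ≥ x₀` in the polylog
  regime and all data of polylog size, `‖parityTernarySum − 𝔖 · parityModelCount‖ ≤ ε · Mv₁Mv₂Mv₃/X₃` with the singular series
  `𝔖 = paritySingSeries α σ d₁ d₂` of `SmoothParitySingular`.

## References

* A. J. Harper, Compositio Math. 152 (2016), §5 [Harper2016].
* J. C. Lagarias, K. Soundararajan, Proc. LMS 104 (2012) [LagariasSoundararajan2012].
-/

noncomputable section

open Finset Real Complex
open scoped ArithmeticFunction

namespace Literature.NumberTheory.Sieve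

namespace SmoothArcs

/-- The weighted count of `y`-friable solutions of `d₁ n₁ + σ d₂ n₂ = n₃` with `n₁ ≤ X₁`, `n₂ ≤ X₂` ODD, `n₃ ≤ X₃` free, and
W-class profile weights `p_{c₁}(n₁/X₁) p_{c₂}(n₂/X₂) conj p_{c₃}(n₃/X₃)`. [cite: Harper2016, §5] -/
def parityTernarySum (y : ℕ) (σ : ℤ) (d₁ d₂ : ℕ) (X₁ X₂ X₃ : ℝ) (c₁ c₂ c₃ : ℤ → ℂ) : ℂ :=
  ∑ n₁ ∈ (Nat.smoothNumbersUpTo ⌊X₁⌋₊ (y + 1)).filter (fun n => Odd n),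
    ∑ n₂ ∈ (Nat.smoothNumbersUpTo ⌊X₂⌋₊ (y + 1)).filter (fun n => Odd n),
      ∑ n₃ ∈ Nat.smoothNumbersUpTo ⌊X₃⌋₊ (y + 1),
        if (d₁ * n₁ : ℤ) + σ * (d₂ * n₂) = n₃ then
          profileFn c₁ ((n₁ : ℝ) / X₁) * profileFn c₂ ((n₂ : ℝ) / X₂) * starRingEnd ℂ (profileFn c₃ ((n₃ : ℝ) / X₃))
        else 0

/-- The MODEL count: the same equation over all `1 ≤ n_i ≤ X_i` with the model weights `profileModelWeight c_i Mv_i X_i α`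
(`Mv_i = e_i^{−α} 𝓜`). [cite: Harper2016, §5] -/
def parityModelCount (σ : ℤ) (d₁ d₂ : ℕ) (X₁ X₂ X₃ Mv₁ Mv₂ Mv₃ α : ℝ) (c₁ c₂ c₃ : ℤ → ℂ) : ℂ :=
  ∑ n₁ ∈ Icc 1 ⌊X₁⌋₊, ∑ n₂ ∈ Icc 1 ⌊X₂⌋₊, ∑ n₃ ∈ Icc 1 ⌊X₃⌋₊,
    if (d₁ * n₁ : ℤ) + σ * (d₂ * n₂) = n₃ then
      profileModelWeight c₁ Mv₁ X₁ α n₁ * profileModelWeight c₂ Mv₂ X₂ α n₂ *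
        starRingEnd ℂ (profileModelWeight c₃ Mv₃ X₃ α n₃)
    else 0

/-- **THE ZEROTH-ORDER ASYMPTOTIC (statement).**  Under the currency "for every `ε₀ > 0` some `C_F` bounds all non-principal
smooth-weighted friable character sums by `C_F (1+|λ|)³ X^{1/2+ε₀} q^{ε₀}`": for every `B` and `ε > 0` there is `x₀` such that
for `x ≥ x₀`, `(log x)^{4000} ≤ y`, `log y ≤ ¼ (log x)^{1/6}`, `y^{400} ≤ x`, `1 − 2·10⁻⁵ ≤ α(x,y)`, all scalings
`1 ≤ e_i ≤ (log x)^B`, dilations `d₁` even, `d₂` odd, `1 ≤ d_i ≤ (log x)^B` with `d₁ (x/e₁), d₂ (x/e₂), x/e₃ ≤ x/4`, `σ = ±1`, and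
cube-summable profiles with `profileNorm c_i ≤ (log x)^{10}` and `|p_{c_i}| ≤ 1` (plateau profiles with transition width `1/log x`
qualify):
`‖parityTernarySum − paritySingSeries α σ d₁ d₂ · parityModelCount‖ ≤ ε · Mv₁ Mv₂ Mv₃ / X₃`,
`Mv_i = e_i^{−α} 𝓜`, `𝓜 = x^α ζ(α,y)/√(2π φ₂(α,y))`, `X_i = x/e_i`, `α = saddlePoint x y`.
[cite: LagariasSoundararajan2012, Thm 1.3 (shape)] [cite: Harper2016, §5] -/
def ParityTernaryAsymptotic : Prop :=
  (∀ ε₀ : ℝ, 0 < ε₀ → ∃ C_F : ℝ, 0 < C_F ∧ ∀ (q : ℕ) (χ : DirichletCharacter ℂ q), q ≠ 0 → χ ≠ 1 →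
      ∀ (y : ℕ) (X lam : ℝ), 1 ≤ X →
        ‖∑ n ∈ Nat.smoothNumbersUpTo ⌊X⌋₊ (y + 1), χ (n : ZMod q) * TwistedWeight.twistWeight lam (n / X)‖ ≤
          C_F * (1 + |lam|) ^ 3 * X ^ (1 / 2 + ε₀) * (q : ℝ) ^ ε₀) →
  ∀ (B : ℕ) (ε : ℝ), 0 < ε → ∃ x₀ : ℝ, ∀ (x : ℝ) (y : ℕ), x₀ ≤ x → Real.log x ^ 4000 ≤ (y : ℝ) →
    Real.log (y : ℝ) ≤ 1 / 4 * Real.log x ^ (1 / 6 : ℝ) → (y : ℝ) ^ 400 ≤ x → 1 - 2 / 100000 ≤ saddlePoint x y →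
    ∀ (σ : ℤ), (σ = 1 ∨ σ = -1) →
    ∀ (e₁ e₂ e₃ d₁ d₂ : ℕ), 1 ≤ e₁ → 1 ≤ e₂ → 1 ≤ e₃ → 1 ≤ d₁ → 1 ≤ d₂ → Even d₁ → Odd d₂ →
      (e₁ : ℝ) ≤ Real.log x ^ B → (e₂ : ℝ) ≤ Real.log x ^ B → (e₃ : ℝ) ≤ Real.log x ^ B →
      (d₁ : ℝ) ≤ Real.log x ^ B → (d₂ : ℝ) ≤ Real.log x ^ B →
      (d₁ : ℝ) * (x / e₁) ≤ x / 4 → (d₂ : ℝ) * (x / e₂) ≤ x / 4 → x / e₃ ≤ x / 4 →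
    ∀ (c₁ c₂ c₃ : ℤ → ℂ),
      Summable (fun ℓ : ℤ => ‖c₁ ℓ‖ * (1 + |(ℓ : ℝ)|) ^ 3) → Summable (fun ℓ : ℤ => ‖c₂ ℓ‖ * (1 + |(ℓ : ℝ)|) ^ 3) →
      Summable (fun ℓ : ℤ => ‖c₃ ℓ‖ * (1 + |(ℓ : ℝ)|) ^ 3) →
      profileNorm c₁ ≤ Real.log x ^ 10 → profileNorm c₂ ≤ Real.log x ^ 10 → profileNorm c₃ ≤ Real.log x ^ 10 →
      (∀ v : ℝ, ‖profileFn c₁ v‖ ≤ 1) → (∀ v : ℝ, ‖profileFn c₂ v‖ ≤ 1) → (∀ v : ℝ, ‖profileFn c₃ v‖ ≤ 1) →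
      ‖parityTernarySum y σ d₁ d₂ (x / e₁) (x / e₂) (x / e₃) c₁ c₂ c₃ -
          paritySingSeries (saddlePoint x y) σ d₁ d₂ *
            parityModelCount σ d₁ d₂ (x / e₁) (x / e₂) (x / e₃)
              ((e₁ : ℝ) ^ (-saddlePoint x y) * (x ^ saddlePoint x y * smoothZeta (saddlePoint x y) y /
                Real.sqrt (2 * Real.pi * saddlePhi₂ (saddlePoint x y) y)))
              ((e₂ : ℝ) ^ (-saddlePoint x y) * (x ^ saddlePoint x y * smoothZeta (saddlePoint x y) y /
                Real.sqrt (2 * Real.pi * saddlePhi₂ (saddlePoint x y) y)))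
              ((e₃ : ℝ) ^ (-saddlePoint x y) * (x ^ saddlePoint x y * smoothZeta (saddlePoint x y) y /
                Real.sqrt (2 * Real.pi * saddlePhi₂ (saddlePoint x y) y)))
              (saddlePoint x y) c₁ c₂ c₃‖ ≤
        ε * (((e₁ : ℝ) ^ (-saddlePoint x y) * (e₂ : ℝ) ^ (-saddlePoint x y) * (e₃ : ℝ) ^ (-saddlePoint x y)) *
          (x ^ saddlePoint x y * smoothZeta (saddlePoint x y) y /
            Real.sqrt (2 * Real.pi * saddlePhi₂ (saddlePoint x y) y)) ^ 3 / (x / e₃))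

end SmoothArcs

end Literature.NumberTheory.Sieve

end
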